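import Summits.BirchSwinnertonDyer.BirchSwinnertonDyer.Theorems.ClassRecordThreeCornerAtThreeModularHeegnerLabels
import Summits.BirchSwinnertonDyer.BirchSwinnertonDyer.Theorems.ClassRecordThreeEulerHalvesAtThreeKolyImageIndexFormEndDiv
import Summits.BirchSwinnertonDyer.BirchSwinnertonDyer.Theorems.ClassRecordThreeEulerHalvesAtThreeShimuraCarrierDiv
import Summits.BirchSwinnertonDyer.BirchSwinnertonDyer.Theorems.ClassRecordThreeCornerAtThreeShimuraWalkPresentationTransfer
import Summits.BirchSwinnertonDyer.BirchSwinnertonDyer.Theorems.ClassRecordThreeCornerAtThreeKolyImageInputsInert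
import Summits.BirchSwinnertonDyer.Rank1Residual.X11b.RingClassFieldNoTorsionOfIrreducible
import Summits.BirchSwinnertonDyer.Rank1Residual.X11b.KolyvaginH37Bridge
import Summits.BirchSwinnertonDyer.Rank1Residual.X11b.SplitPrimeUnramified
import Summits.BirchSwinnertonDyer.Rank1Residual.X11b.Three.KolyvaginLine
import Literature.NumberTheory.EllipticCurves.CasselsTateLevelInputs
import Literature.NumberTheory.EllipticCurves.Cha2005.ShaStructureIrreducible
import Literature.NumberTheory.EllipticCurves.McCallum1991.EigenclassesCebotarevLevelPow
import HarnessLib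

/-!
# Cha 2005 Rmk. 25 ∕ McCallum 1991 Cor. 5.6 — the IRREDUCIBLE-IMAGE structure bound `ord_p #Ш(E/K)[p^∞] + 2t ≤ 2M₀` under global
# divisibility — BY KERNEL at `p = 3` (and at every odd `p` carrying the four image inputs), from the Cassels–Tate level inputs and
# Gross's Prop. 3.7 (2) alone: the named fact `hChaU` of the mono-carrier branch of crux `CornerAtThreeW` (item stmt-BirchSwinnertonDyer-21420,
# `Lines/inert.lean` r10) DISCHARGED on its frames (cell `bsd-stepL`, seat `bsd-stepL-corner3-p2` g11 = WIDTH-LEVER lane B; `--supports … --as helper`)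

WHY. `residual3_of_stubs` (mono branch) → lane A's END `Three.missingUpperBoundAt_monoCarrier_of_threeNamedFacts_of_twinLowerModEight` turns the Jetchev
MAX walk's global divisibility into a bound on `Ш` through ONE cited XL fact, `Cha2005.rmk25_padicValNat_card_sha_primary_add_le_of_globalDivisibility`
(Cha 2005 Thm. 21 + Rmk. 25 ∕ Matar–Nekovář 2019 §0.11; no `_holds`). THIS FILE proves its content BY KERNEL on the line's frames (§2 any odd `p`
with the four image inputs (hIz) (hIs) (hIc) (hIt); §3 `p = 3`, EVERY irreducible `E[3]` — `kolyvaginImageInputs_three_of_not_dvd_discr`), for `K`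
imaginary quadratic Heegner with `d_K ∉ {−3, −4}` and `2` NOT inert (the line's `d_K ≡ 1 (mod 8)` frames, RULING 38).

HOW (assembly of the cell's kernel machines; no new mathematics): the `X₀(N)` Heegner family as a LABELLED family (`ModularHeegnerLabels`, this
seat g11); §1 the LABEL-SIDE global divisibility `hDivLab` of D6 for EVERY presentation of Kolyvagin's operator, from the divisibility of the concrete
`d.derivedPoint` — x11b3's H37 bridge (`KolyvaginH37Bridge.map_kolyvaginPoint_eq_derivedPoint`) for the transversal presentation, lane B g8's «ONE ⟹ ALL»
transfer (`ShimuraWalk.exists_smul_eq_kolyvaginPoint_of_presentation`, Gross Prop. 3.6) for the others; tam3-p1 g11's Div-carrier D6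
(`hpointsRkDiv_of_shimuraLabels_of_noTorsion_of_divLab`) and the image-keyed END D4 (`card_sha_primary_le_of_ringClassRationalPointsMDiv_shift_of_poitouTate_of_localDuality_ofImage`;
`M₀ = 0`: `sha_primary_eq_zero_of_ringClassRationalPointsM_shift_ofImage`) on the frame `S = ∅` — all bad places split (Heegner) and ABSORBED BY THE LEVEL
SHIFT, so NO `E⁰`-statement ([GZ86 III (3.1)]) enters; Poitou–Tate = `poitouTate_sum_localTatePairing_eq_zero_holds`; the Cassels–Tate data at level
`p^{M₀}` from `casselsTate_levelInputs K` as in tam3-p1 g9's McCallum derivation (`…KolyvaginShaOrderDivisibleEnd`); ring-class no-torsion = x11b3's `NoTorsionIrr`.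

WHAT THIS BUYS: §3 has the fact's binder list at `p = 3` plus «`2` not inert», «`3` split in `K`» (automatic on the corner's mono frames), CONDITIONAL
on `casselsTate_levelInputs K` (conjunct 1 of `stub_upper3_inertDisplay`) and `GrossLMS1991.prop37_2_frobeniusCongruence` (conjunct 1 of
`stub_upper3_monoNamedFacts`) ONLY. Successor: lane A's mono END re-keyed `hChaU ↦ hCT`; r11 of `Lines/inert.lean`.

HONEST FRAMING: THEOREMS ONLY (no definition, no named fact, no `sorry`, no instance); CONDITIONAL on the displayed binders; nothing booked; no stub
closes; items 21420 ∕ 19111 NOT closed; the general-`p` named fact (all irreducible images at `p ≥ 5`, `p` inert in `K` allowed) is NOT discharged here;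
BSD is proved for no curve; T7. Credit: x11b3 (cell b2b-bsdres), tam3-p1 (D1–D6, the McCallum wrapper), shim-p1 ∕ shim3b (ORDER chain, image leaves), lane B g5–g10.
References: [Cha2005] Thm. 21, Rmk. 25 (pp. 173–175); [MatarNekovar2019] Thm. 0.7, §0.9, §0.11; [McCallumLMS1991] §1, §4 (4)–(6), Cor. 4.5, §5 Lemma 5.1,
Cor. 5.6; [Jetchev2008] (1), Cor. 1.5; [GrossLMS1991] §3 Prop. 3.6, 3.7, §4 (4.1), §5, §9; [MilneADT2006] I §6.
presearch: «Kolyvagin structure theorem irreducible image p = 3» → [corpus: Cha2005 Thm 21/Rmk 25; MatarNekovar2019 §0.11] are the statements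
discharged; nothing in corpus+galaxy proves them for a non-surjective image otherwise; tree: the machines above
(lean search 'ofImage|hpointsRkDiv|exists_smul_eq_kolyvaginPoint_of_presentation').
-/

set_option autoImplicit false
set_option linter.dupNamespace false

noncomputable section

open scoped Classical NumberField

namespace Summit.BirchSwinnertonDyer.BirchSwinnertonDyer.Theorems.ModularHeegnerCha

open WeierstrassCurve Field NumberField IsDedekindDomain Finset Function
open Literature.NumberTheory.EllipticCurves Literature.NumberTheory.GaloisRepresentations
  Literature.NumberTheory.GaloisCohomology
  Literature.NumberTheory.EllipticCurves.KolyvaginCocycle Literature.NumberTheory.EllipticCurves.KolyvaginEuler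
  Literature.NumberTheory.EllipticCurves.RingClassField Literature.NumberTheory.EllipticCurves.ModularForms
  Summit.BirchSwinnertonDyer.Rank1Residual.X11b
  Summit.BirchSwinnertonDyer.BirchSwinnertonDyer.Theorems.ShimuraKolyvaginOfImage

-- `K : Type`: the tree's ring-class class field theory is universe `0`.
variable {K : Type} [Field K] [NumberField K] {W : WeierstrassCurve ℚ}

/-! ### §1 The LABEL-SIDE global divisibility of D6 from the divisibility of the concrete derived points -/

/-- **`hDivLab` (D6's binder, VERBATIM) from global divisibility of the tree's derived Heegner points**: for a family `ys` which IS
`φ(x(m))` at every good conductor and carries (B4), an odd `p`, and `p^s`-divisibility of every concrete `d.derivedPoint` (`s ≤ t`, Zhang–Kolyvagin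
primes of index `≥ s`): `p^{M−t}·P_{k′}(σ′, H′, f′) ∈ p^M E(K[k′])` for EVERY presentation. Transversal presentation = `P(k′)` (x11b3's H37 bridge);
any presentation by lane B g8's transfer. [cite: GrossLMS1991, §3 Prop. 3.6, §4 (4.1)] [cite: McCallumLMS1991, §4 (4)–(6), Cor. 4.5] -/
theorem divLab_of_globalDivisibility [W.IsElliptic] [W.IsGloballyMinimal] [NeZero (W.conductorNorm ℤ)]
    (hK : IsImaginaryQuadratic K)
    (Dt : ModularParametrizationData W (W.conductorNorm ℤ)) {β : ℤ}
    (hβ : (4 * (W.conductorNorm ℤ : ℕ) : ℤ) ∣ β ^ 2 - NumberField.discr K) (ι : K →+* ℂ)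
    {p : ℕ} (hp : p.Prime)
    (ys : (m : ℕ) → (W.baseChange (ringClassField K ι m)).toAffine.Point)
    (hcm : ∀ m : ℕ, Squarefree m →
      (∀ q ∈ m.primeFactors, ¬ q ∣ W.conductorNorm ℤ ∧ (Ideal.span {(q : 𝓞 K)}).IsPrime) →
      WeierstrassCurve.Affine.Point.map (W' := W) (ringClassField K ι m).subtype.toRatAlgHom (ys m) =
        heegnerPointComplexOfConductor Dt (NumberField.discr K) β m)
    (hB4 : ∀ m : ℕ, Squarefree m →
      (∀ q ∈ m.primeFactors, ¬ q ∣ W.conductorNorm ℤ ∧ (Ideal.span {(q : 𝓞 K)}).IsPrime) →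
      ∀ (ℓ : ℕ) (_ : ℓ ∈ m.primeFactors) (hle : ringClassField K ι (m / ℓ) ≤ ringClassField K ι m)
        (σ : ringClassField K ι m ≃ₐ[ℚ] ringClassField K ι m),
        Subgroup.zpowers σ = ringClassGalOver ι m (m / ℓ) →
        letI : Algebra K ℂ := ι.toAlgebra
        ∑ i ∈ Finset.range (ℓ + 1), pointGalHom W (ringClassField K ι m) (σ ^ i) (ys m) =
          W.frobeniusTrace ℓ • WeierstrassCurve.Affine.Point.map (W' := W)
            ((RingClassField.inclusion ι hle).restrictScalars ℚ) (ys (m / ℓ)))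
    (t : ℕ)
    (hglob : ∀ (s : ℕ), s ≤ t → ∀ (n : ℕ) (d : KolyvaginHeegnerData Dt β ι n), Squarefree n →
      (∀ ℓ ∈ n.primeFactors, Zhang2014.IsKolyvaginPrime (W.conductorNorm ℤ) W K p ℓ ∧
        s ≤ Zhang2014.kolyvaginIndex W p ℓ) →
      ∃ Q : (W.baseChange (ringClassField K ι n)).toAffine.Point, ((p ^ s : ℕ) : ℤ) • Q = d.derivedPoint) :
    ∀ (k M k' : ℕ), Squarefree k' →
      (∀ q ∈ k'.primeFactors, IsKolyvaginPrime (W.conductorNorm ℤ) W K p q ∧ FrobEqFrobInfty W K (p ^ (M + k)) q) →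
      letI : CommGroup (ringClassGal ι k') := { (inferInstance : Group (ringClassGal ι k')) with
        mul_comm := fun a b ↦ (KolyvaginH44.isMulCommutative_ringClassGal' hK ι k').is_comm.comm a b }
      letI : DistribMulAction (ringClassGal ι k') ((W.baseChange (ringClassField K ι k')).toAffine.Point) :=
        DistribMulAction.compHom _ ((pointGalHom W (ringClassField K ι k')).comp (ringClassGal ι k').subtype)
      ∀ (σ' : ℕ → ringClassGal ι k') (H' : Subgroup (ringClassGal ι k')) [Fintype (ringClassGal ι k' ⧸ H')]
        (f' : ringClassGal ι k' ⧸ H' → ringClassGal ι k'),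
        (∀ q ∈ k'.primeFactors, σ' q ^ (q + 1) = 1) →
        (∀ q ∈ k'.primeFactors, Subgroup.zpowers (σ' q : ringClassField K ι k' ≃ₐ[ℚ] ringClassField K ι k') =
          ringClassGalOver ι k' (k' / q)) →
        (∀ c, (f' c : ringClassGal ι k' ⧸ H') = c) →
        (∀ h ∈ H', (h : ringClassField K ι k' ≃ₐ[ℚ] ringClassField K ι k') ∈ ringClassGalOver ι k' 1) →
        ∃ B : (W.baseChange (ringClassField K ι k')).toAffine.Point,
          ((p ^ M : ℕ) : ℤ) • B = ((p : ℤ) ^ (M - t)) • kolyvaginPoint σ' k'.primeFactors f' (ys k') := by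
  intro k M k' hk' hkol'
  -- the statement's instances, as local instances (so that new terms elaborate against them)
  letI instCG : CommGroup (ringClassGal ι k') := { (inferInstance : Group (ringClassGal ι k')) with
    mul_comm := fun a b ↦ (KolyvaginH44.isMulCommutative_ringClassGal' hK ι k').is_comm.comm a b }
  letI instAct : DistribMulAction (ringClassGal ι k') ((W.baseChange (ringClassField K ι k')).toAffine.Point) :=
    DistribMulAction.compHom _ ((pointGalHom W (ringClassField K ι k')).comp (ringClassGal ι k').subtype)
  intro σ' H' _ f' hord' hz' hf' hH'
  rcases Nat.eq_zero_or_pos M with rfl | hMpos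
  · refine ⟨kolyvaginPoint σ' k'.primeFactors f' (ys k'), ?_⟩
    rw [Nat.zero_sub, pow_zero, pow_zero, Nat.cast_one]
  have hMk : 1 ≤ M + k := le_trans hMpos (Nat.le_add_right M k)
  -- `k'` is a good conductor: square-free, Kolyvagin prime factors (prime to `N`, inert)
  have hgood : ∀ q ∈ k'.primeFactors, ¬ q ∣ W.conductorNorm ℤ ∧ (Ideal.span {(q : 𝓞 K)}).IsPrime :=
    fun q hq ↦ ⟨(hkol' q hq).1.2.1, (hkol' q hq).1.2.2.2.2.1⟩
  have hk'0 : k' ≠ 0 := hk'.ne_zero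
  -- concrete Kolyvagin–Heegner data along the divisors of `k'` carrying the family (x11b3-p8's coherent tower)
  obtain ⟨d, hdy, hdord, -⟩ := RingClassTower.exists_coherent_kolyvaginHeegnerData Dt hK ι hk'
    (fun q hq ↦ (hgood q hq).2) hβ (fun m _ ↦ ys m)
    (fun m hm ↦ hcm m (hk'.squarefree_of_dvd hm) fun q hq ↦ hgood q (Nat.primeFactors_mono hm hk'0 hq))
  set dk : KolyvaginHeegnerData Dt β ι k' := d k' dvd_rfl with hdk
  -- the abstract frame of the transfer: `𝒢 = 𝒢_{k'}` acting on `A₀ = E(K[k'])` through the inclusion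
  haveI hfin : Finite (ringClassGal ι k') := KolyvaginH44.finite_ringClassGal hK ι k'
  set ρ : ringClassGal ι k' →* (ringClassField K ι k' ≃ₐ[ℚ] ringClassField K ι k') :=
    (ringClassGal ι k').subtype with hρ
  have hρi : Function.Injective ρ := (ringClassGal ι k').subtype_injective
  have h𝒢ρ : ∀ g : ringClassGal ι k', ρ g ∈ ringClassGal ι k' := fun g ↦ g.2
  have hsmul : ∀ (g : ringClassGal ι k') (a : (W.baseChange (ringClassField K ι k')).toAffine.Point),
      g • a = pointGalHom W (ringClassField K ι k') (ρ g) a := fun _ _ ↦ rfl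
  have hiA : ∀ (g : ringClassGal ι k') (a : (W.baseChange (ringClassField K ι k')).toAffine.Point),
      (AddEquiv.refl _) (g • a) = pointGalHom W (ringClassField K ι k') (ρ g) ((AddEquiv.refl _) a) := hsmul
  have hB4' : ∀ ℓ ∈ k'.primeFactors, ∀ σ : ringClassField K ι k' ≃ₐ[ℚ] ringClassField K ι k',
      Subgroup.zpowers σ = ringClassGalOver ι k' (k' / ℓ) →
      ∃ y' : (W.baseChange (ringClassField K ι k')).toAffine.Point,
        ∑ i ∈ Finset.range (ℓ + 1), pointGalHom W (ringClassField K ι k') (σ ^ i)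
            ((AddEquiv.refl _) (ys k')) = W.frobeniusTrace ℓ • y' := by
    intro ℓ hℓ σ hσ
    have hle : ringClassField K ι (k' / ℓ) ≤ ringClassField K ι k' :=
      ringClassField_mono hK ι (Nat.div_dvd_of_dvd (Nat.dvd_of_mem_primeFactors hℓ)) hk'0
    exact ⟨_, hB4 k' hk' hgood ℓ hℓ hle σ hσ⟩
  -- presentation 1: the TRANSVERSAL presentation of the datum `dk` (generators `dk.σ`, transversal `dk.S`)
  have hσmem : ∀ q ∈ k'.primeFactors, dk.σ q ∈ ringClassGal ι k' := fun q hq ↦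
    ringClassGalOver_le_ringClassGal ι k' (k' / q) (by rw [← dk.zpowers_σ q hq]; exact Subgroup.mem_zpowers _)
  let σ₁ : ℕ → ringClassGal ι k' := fun q ↦ if hq : q ∈ k'.primeFactors then ⟨dk.σ q, hσmem q hq⟩ else 1
  have hσ₁ : ∀ q ∈ k'.primeFactors, ρ (σ₁ q) = dk.σ q := fun q hq ↦ by
    simp only [σ₁, dif_pos hq]
    rfl
  have hz₁ : ∀ q ∈ k'.primeFactors, (Subgroup.zpowers (σ₁ q)).map ρ = ringClassGalOver ι k' (k' / q) :=
    fun q hq ↦ by rw [MonoidHom.map_zpowers, hσ₁ q hq]; exact dk.zpowers_σ q hq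
  have hord₁ : ∀ q ∈ k'.primeFactors, σ₁ q ^ (q + 1) = 1 := fun q hq ↦ by
    apply hρi
    rw [map_pow, hσ₁ q hq, map_one]
    exact hdord k' dvd_rfl q hq
  set H₁ : Subgroup (ringClassGal ι k') := (ringClassGalOver ι k' 1).comap ρ with hH₁def
  letI : Fintype (ringClassGal ι k' ⧸ H₁) := Fintype.ofFinite _
  have hH₁ : ∀ h ∈ H₁, ρ h ∈ ringClassGalOver ι k' 1 := fun h hh ↦ Subgroup.mem_comap.mp hh
  have hS₁ρ : ((dk.S : Set (ringClassField K ι k' ≃ₐ[ℚ] ringClassField K ι k'))) ⊆ Set.range ρ :=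
    fun s hs ↦ ⟨⟨s, dk.S_subset s hs⟩, rfl⟩
  obtain ⟨f₁, hf₁, hf₁S⟩ := exists_section_comap_of_transversal ι k' ρ h𝒢ρ hS₁ρ dk.S_transversal
  -- the transversal presentation IS `P(k')` (x11b3's H37 bridge)
  have hbij := KolyvaginH37Bridge.bijOn_of_section_of_transversal ρ hρi (H := H₁)
    (Γ := ringClassGal ι k') (G₁ := ringClassGalOver ι k' 1) hH₁ (S := (dk.S : Set _))
    (fun s hs ↦ dk.S_subset s hs) hS₁ρ dk.S_transversal f₁ hf₁ hf₁S
  have hP₁ : kolyvaginPoint σ₁ k'.primeFactors f₁ (ys k') = dk.derivedPoint := by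
    have h := KolyvaginH37Bridge.map_kolyvaginPoint_eq_derivedPoint
      (pointGalHom W (ringClassField K ι k')) ρ (AddMonoidHom.id _) (fun g a ↦ hsmul g a) hk' hσ₁ f₁ hbij dk.y
    rw [AddMonoidHom.id_apply, AddMonoidHom.id_apply] at h
    rw [← hdy k' dvd_rfl]
    exact h
  -- the fact's divisibility at depth `μ := min M t` on the datum `dk` (index ≥ M + k ≥ M ≥ μ)
  have hZ : ∀ ℓ ∈ k'.primeFactors, Zhang2014.IsKolyvaginPrime (W.conductorNorm ℤ) W K p ℓ ∧
      min M t ≤ Zhang2014.kolyvaginIndex W p ℓ := by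
    intro ℓ hℓ
    obtain ⟨⟨hℓP, hℓN, hℓD, hℓp, hprime, -⟩, hfrob⟩ := hkol' ℓ hℓ
    have hidx : M + k ≤ Zhang2014.kolyvaginIndex W p ℓ :=
      McCallum1991.le_kolyvaginIndex_of_frobEqFrobInfty W K hp hMk hℓP hℓp hℓN hfrob
    exact ⟨⟨hℓP, hℓN, hℓD, hℓp, hprime, lt_of_lt_of_le (by omega) hidx⟩, by omega⟩
  obtain ⟨Q, hQ⟩ := hglob (min M t) (min_le_right M t) k' dk hk' hZ
  have h₁ : ∃ B : (W.baseChange (ringClassField K ι k')).toAffine.Point,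
      ((p ^ min M t : ℕ) : ℤ) • B = kolyvaginPoint σ₁ k'.primeFactors f₁ (ys k') := ⟨Q, by rw [hP₁, hQ]⟩
  -- «ONE ⟹ ALL» (lane B g8): the given presentation is `p^{min M t}`-divisible too
  have hz' : ∀ q ∈ k'.primeFactors, (Subgroup.zpowers (σ' q)).map ρ = ringClassGalOver ι k' (k' / q) :=
    fun q hq ↦ by rw [MonoidHom.map_zpowers]; exact hz' q hq
  obtain ⟨B, hB⟩ := ShimuraWalk.exists_smul_eq_kolyvaginPoint_of_presentation hK ι Dt hp hMk hk' hkol' ρ hρi h𝒢ρ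
    (AddEquiv.refl _) hiA (ys k') hB4' σ₁ H₁ f₁ dk.S hH₁ hf₁ hf₁S dk.S_subset hS₁ρ dk.S_transversal hz₁ hord₁
    σ' H' f' hH' hf' hz' hord' (μ := min M t) (by omega) h₁
  have hexp : ((p ^ M : ℕ) : ℤ) = ((p : ℤ) ^ (M - t)) * ((p ^ min M t : ℕ) : ℤ) := by
    push_cast; rw [← pow_add]; congr 1; omega
  exact ⟨B, by rw [hexp, mul_smul, hB]⟩

/-! ### §2 The structure bound under global divisibility, for any odd `p` carrying the four image inputs -/

/-- **Cha 2005 Rmk. 25 ∕ McCallum 1991 Cor. 5.6, upper half under global divisibility — BY KERNEL for any odd `p` with the four image inputs.**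
`E = W/ℚ` elliptic, globally minimal, conductor `N`; `K` imaginary quadratic Heegner, `d_K ∉ {−3, −4}`, `2` NOT inert; `p` odd with (hIz) (hIs) (hIc) (hIt)
and `htor`; a frame `(Dt, β, ι)`, a conductor-`1` datum `d₁` with derived point `P` (infinite order, `p^{M₀} ∥ P`): if every `P_n` on the frame
(square-free `n` on Zhang–Kolyvagin primes of index `≥ s`) is `p^s`-divisible for all `s ≤ t`, then `ord_p #Ш(E/K)[p^∞] + 2t ≤ 2M₀`. CONDITIONAL on
`hCT` and `h372` only. [cite: Cha2005, Thm. 21 and Rmk. 25 (pp. 173–175)] [cite: McCallumLMS1991, §1 Theorem, §4 Cor. 4.5, §5 Lemma 5.1, Cor. 5.6]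
[cite: Jetchev2008, p. 812 (1) and Cor. 1.5] [cite: GrossLMS1991, §3 Prop. 3.6, Prop. 3.7 (2), §4 (4.1)] [cite: MilneADT2006, Ch. I §6, Thm. 6.13(a)] -/
theorem padicValNat_card_sha_primary_add_le_of_globalDivisibility_ofImage
    [W.IsElliptic] [W.IsGloballyMinimal] [NeZero (W.conductorNorm ℤ)]
    (hCT : casselsTate_levelInputs K) (h372 : GrossLMS1991.prop37_2_frobeniusCongruence)
    (hK : IsImaginaryQuadratic K) (hD3 : NumberField.discr K ≠ -3) (hD4 : NumberField.discr K ≠ -4)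
    (hH : SatisfiesHeegnerHypothesis (W.conductorNorm ℤ) K)
    (h2 : ¬ (Ideal.span {((2 : ℕ) : 𝓞 K)}).IsPrime)
    {p : ℕ} [Fact p.Prime] (hp2 : p ≠ 2)
    (hIz : ∃ z : absoluteGaloisGroup K, ∀ t : geomTorsion (W.baseChange K) p, z • t = -t)
    (hIs : (W.baseChange K).HasIrreducibleModPGaloisRep p)
    (hIc : ∀ f : geomTorsion (W.baseChange K) p →+ geomTorsion (W.baseChange K) p,
      (∀ (g : absoluteGaloisGroup K) (t : geomTorsion (W.baseChange K) p), f (g • t) = g • f t) →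
        ∃ k : ℤ, ∀ t, f t = k • t)
    (hIt : AddSubgroup.torsionBy (W.baseChange K).toAffine.Point (p : ℤ) = ⊥)
    (ι : K →+* ℂ)
    (htor : ∀ k' : ℕ, k' ≠ 0 → ¬ p ∣ k' →
      ∀ (n' : ℕ) (a : (W.baseChange (ringClassField K ι k')).toAffine.Point),
        ((p ^ n' : ℕ) : ℤ) • a = 0 → a = 0)
    (Dt : ModularParametrizationData W (W.conductorNorm ℤ)) {β : ℤ}
    (d₁ : KolyvaginHeegnerData Dt β ι 1) {P : (W.baseChange K).toAffine.Point}
    (hPd : d₁.toGeomPoints d₁.derivedPoint = toGeomPoints (W.baseChange K) P)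
    (hnt : ¬ IsOfFinAddOrder P) {M₀ : ℕ}
    (hM₀div : ∃ Q : (W.baseChange K).toAffine.Point, ((p ^ M₀ : ℕ) : ℤ) • Q = P)
    (hM₀max : ¬ ∃ Q : (W.baseChange K).toAffine.Point, ((p ^ (M₀ + 1) : ℕ) : ℤ) • Q = P)
    (t : ℕ)
    (hglob : ∀ (s : ℕ), s ≤ t → ∀ (n : ℕ) (d : KolyvaginHeegnerData Dt β ι n), Squarefree n →
      (∀ ℓ ∈ n.primeFactors, Zhang2014.IsKolyvaginPrime (W.conductorNorm ℤ) W K p ℓ ∧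
        s ≤ Zhang2014.kolyvaginIndex W p ℓ) →
      ∃ Q : (W.baseChange (ringClassField K ι n)).toAffine.Point, ((p ^ s : ℕ) : ℤ) • Q = d.derivedPoint) :
    padicValNat p (Nat.card (AddCommGroup.primaryComponent (W.baseChange K).sha p)) + 2 * t ≤ 2 * M₀ := by
  haveI : (W.baseChange K).IsElliptic := inferInstanceAs (W.map (algebraMap ℚ K)).IsElliptic
  have hp : p.Prime := Fact.out
  have hD34 : NumberField.discr K ≠ -3 ∧ NumberField.discr K ≠ -4 := ⟨hD3, hD4⟩
  -- the labelled `X₀(N)` family on the frame (this seat's `ModularHeegnerLabels`)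
  obtain ⟨ys, -, hcm, hε, hB2, hB3, hB3K, hB4, hB5⟩ :=
    ModularHeegnerLabels.exists_labelledFamily rfl hK hD34 hH h2 h372 Dt ι d₁ hPd
  -- the LABEL-SIDE global divisibility (§1) and the Div-carrier (D6)
  have hDivLab := divLab_of_globalDivisibility hK Dt d₁.dvd_sq_sub ι hp ys hcm hB4 t hglob
  have hpointsRk := hpointsRkDiv_of_shimuraLabels_of_noTorsion_of_divLab hK ι rfl Dt hp hp2 htor ys hε hB2 hB3
    hB3K hB4 hB5 t hDivLab
  -- Poitou–Tate (tree theorem) and the frame `S = ∅` (every bad prime split: the Heegner hypothesis)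
  have hPT := poitouTate_sum_localTatePairing_eq_zero_holds K
  have hin : ∀ ℓ ∈ (∅ : Finset ℕ), ℓ.Prime ∧ ℓ ∣ W.conductorNorm ℤ ∧ ¬ ℓ ^ 2 ∣ W.conductorNorm ℤ ∧
      ((Ideal.span {(ℓ : ℤ)}).primesOver (𝓞 K)).ncard = 1 ∧ ¬ (ℓ : ℤ) ∣ NumberField.discr K :=
    fun ℓ hℓ ↦ absurd hℓ (Finset.notMem_empty ℓ)
  have hsp : ∀ ℓ : ℕ, ℓ.Prime → ℓ ∣ W.conductorNorm ℤ → ℓ ∉ (∅ : Finset ℕ) →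
      ((Ideal.span {(ℓ : ℤ)}).primesOver (𝓞 K)).ncard = 2 := fun ℓ hℓ hℓN _ ↦ hH ℓ hℓ hℓN
  obtain ⟨x₀, hx₀'⟩ := hM₀div
  have hx₀ : p ^ M₀ • x₀ = P := by rw [← natCast_zsmul]; exact_mod_cast hx₀'
  have hmax : ∀ Q : (W.baseChange K).toAffine.Point, p ^ (M₀ + 1) • Q ≠ P := fun Q hQ ↦
    hM₀max ⟨Q, by rw [← natCast_zsmul] at hQ; exact_mod_cast hQ⟩
  rcases Nat.eq_zero_or_pos M₀ with h0 | hpos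
  · -- `M₀ = 0`: `t = 0` (McCallum Lemma 5.1 at conductor `1`) and `Ш(E/K)[p^∞] = 0` (the image-keyed unit END)
    subst h0
    have hmapP : WeierstrassCurve.Affine.Point.map (W' := W)
        (algebraMap K (ringClassField K ι 1)).toRatAlgHom P = d₁.derivedPoint := by
      apply WeierstrassCurve.Affine.Point.map_injective (W' := W) d₁.emb.toRatAlgHom
      change d₁.toGeomPoints _ = d₁.toGeomPoints _
      rw [KolyvaginBottom.toGeomPoints_map_algebraMap d₁ P, hPd]
    have ht0 : t = 0 := by
      by_contra ht
      obtain ⟨Q₁, hQ₁⟩ := hglob t le_rfl 1 d₁ squarefree_one (by simp)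
      have hP' : Three.Koly.PDiv d₁ p t := ⟨Q₁, hQ₁⟩
      obtain ⟨Q, hQ⟩ := (Three.Koly.pDiv_one_iff_exists_zsmul_eq hK d₁ P hmapP p t
        (fun R hR ↦ htor 1 one_ne_zero (fun h ↦ hp.ne_one (Nat.dvd_one.mp h)) t R hR)).mp hP'
      refine hM₀max ⟨((p ^ (t - 1) : ℕ) : ℤ) • Q, ?_⟩
      rw [smul_smul, ← Nat.cast_mul, ← pow_add, show 0 + 1 + (t - 1) = t by omega, hQ]
    subst ht0
    have hndvd : ∀ Q : (W.baseChange K).toAffine.Point, p • Q ≠ P := fun Q hQ ↦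
      hmax Q (by rwa [zero_add, pow_one])
    have hpointsRk' : ∀ (k : ℕ) {M : ℕ} (_hM : 1 ≤ M)
        (hdiv : ∀ Q : geomPoints (W.baseChange K), ∃ R, ((p ^ M : ℕ) : ℤ) • R = Q)
        (c : K ≃ₐ[ℚ] K) (_hc : c ≠ 1),
        ∃ (ε : ℤ) (τ : AlgebraicClosure K ≃+* AlgebraicClosure K) (hτ : IsLiftOfAut c τ)
          (A : ℕ → AddSubgroup (geomPoints (W.baseChange K)))
          (hA : ∀ m, KolyvaginCocycle.IsAdmissible (Field.absoluteGaloisGroup K) (A m)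
            ((p ^ M : ℕ) : ℤ))
          (emb : ∀ m : ℕ, ringClassField K ι m →ₐ[K] AlgebraicClosure K)
          (Pt : ℕ → geomPoints (W.baseChange K))
          (hPt : ∀ m, Pt m ∈
            KolyvaginCocycle.invPoints (Field.absoluteGaloisGroup K) (A m) ((p ^ M : ℕ) : ℤ)),
          (ε = 1 ∨ ε = -1) ∧
          IsOfFinAddOrder (Affine.Point.map (W' := W) (c : K →ₐ[ℚ] K) P - ε • P) ∧
          (∀ m, ∀ a ∈ A m, hτ.pointsMap W a ∈ A m) ∧
          Pt 1 = toGeomPoints (W.baseChange K) P ∧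
          (∀ m, m ≠ 0 → ∀ a ∈ A m, ∀ Φ : Field.absoluteGaloisGroup K,
            (∀ x : ringClassField K ι m, Φ • emb m x = emb m x) → Φ • a = a) ∧
          (∀ m, KolyvaginCocycle.IsAdmissible (Field.absoluteGaloisGroup K) (A m)
            ((p ^ (M + k) : ℕ) : ℤ)) ∧
          (∀ m : ℕ, Squarefree m →
            (∀ q ∈ m.primeFactors, IsKolyvaginPrime (W.conductorNorm ℤ) W K p q ∧
              FrobEqFrobInfty W K (p ^ (M + k)) q) →
            Pt m ∈ KolyvaginCocycle.invPoints (Field.absoluteGaloisGroup K) (A m)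
              ((p ^ (M + k) : ℕ) : ℤ) ∧
            (∃ B ∈ A m, hτ.pointsMap W (Pt m) =
              (ε * (-1) ^ m.primeFactors.card) • Pt m + ((p ^ M : ℕ) : ℤ) • B) ∧
            (∀ ℓ : ℕ, ℓ.Prime → ℓ ∣ m → ∀ v : HeightOneSpectrum (𝓞 K), (ℓ : 𝓞 K) ∈ v.asIdeal →
              ∀ a : ℕ, (((p : ℤ) ^ a) •
                  kolyvaginClass (W.baseChange K) _ hdiv (hA m) (Pt m) (hPt m) ∈
                  selmerLocalKer (W.baseChange K) (v.adicCompletion K) ((p ^ M : ℕ) : ℤ) ↔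
                ((p : ℤ) ^ a) • kolyvaginClass (W.baseChange K) _ hdiv (hA (m / ℓ)) (Pt (m / ℓ))
                    (hPt (m / ℓ)) ∈
                  (W.baseChange K).torsionLocalKer (v.adicCompletion K) ((p ^ M : ℕ) : ℤ)))) := by
      intro k M hM hdiv c hc
      obtain ⟨ε, τ, hτ, A, hA, emb, Pt, hPt, hε', h53, hAτ, hPt1, hrat, hAk, hm'⟩ := hpointsRk k hM hdiv c hc
      exact ⟨ε, τ, hτ, A, hA, emb, Pt, hPt, hε', h53, hAτ, hPt1, hrat, hAk, fun m hm hk ↦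
        ⟨(hm' m hm hk).1, (hm' m hm hk).2.1, (hm' m hm hk).2.2.1⟩⟩
    have h0 := sha_primary_eq_zero_of_ringClassRationalPointsM_shift_ofImage W rfl hp hp2 hIz hIs hIc hIt hK ι
      hin hsp hnt hndvd hpointsRk'
      (@fun _ hM _ hℓ _ ↦ kolyvaginReciprocityM_of_poitouTate_of_conductorNorm W rfl hPT hp hM hℓ)
    have hbot : ∀ c ∈ AddCommGroup.primaryComponent (W.baseChange K).sha p, c = 0 := by
      intro c hc
      obtain ⟨j, hj⟩ := (AddCommGroup.mem_primaryComponent).1 hc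
      exact h0 c ⟨j, hj⟩
    have hcard : Nat.card (AddCommGroup.primaryComponent (W.baseChange K).sha p) = 1 := by
      rw [Nat.card_eq_one_iff_exists]
      exact ⟨⟨0, zero_mem _⟩, fun c ↦ Subtype.ext (hbot c.1 c.2)⟩
    rw [hcard]; simp
  -- `M₀ ≥ 1`: D4 on the frame `S = ∅`, with the Weil pairing at level `p^{2M₀}` and the Cassels–Tate inputs
  haveI : NeZero (p ^ M₀) := ⟨pow_ne_zero _ hp.ne_zero⟩
  obtain ⟨c, hc1', hcc⟩ := exists_conj_of_isImaginaryQuadratic (K := K) hK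
  have h2' : 2 ≤ p ^ M₀ * p ^ M₀ :=
    le_trans (le_trans hp.two_le (Nat.le_self_pow hpos.ne' p)) (Nat.le_mul_of_pos_right _ (NeZero.pos (p ^ M₀)))
  have hq : ((p ^ M₀ * p ^ M₀ : ℕ) : K) ≠ 0 := Nat.cast_ne_zero.mpr (NeZero.ne (p ^ M₀ * p ^ M₀))
  obtain ⟨e, hμ, hadd₁, hadd₂, halt, hnd, hgal⟩ :=
    (W.baseChange K).exists_weilPairing_holds (p ^ M₀ * p ^ M₀) h2' hq
  obtain ⟨inv, hPT', hH3, hperf, hB, hPτ⟩ := hCT W p M₀ hp hp2 hpos c hc1' hcc e hμ hadd₁ hadd₂ hgal halt hnd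
  exact (card_sha_primary_le_of_ringClassRationalPointsMDiv_shift_of_poitouTate_of_localDuality_ofImage hPT W rfl hp
    hp2 hIz hIs hIc hIt hK ι hin hsp hnt hpos hc1' hcc hx₀ hmax t hpointsRk e hμ hadd₁ hadd₂ hgal halt hnd inv hPT'
    (fun v ↦ (hperf v).1.injective) hH3 hB hPτ).2.2.2

/-! ### §3 At `p = 3`: EVERY irreducible `E[3]` (the corner's image `N(C)` included) -/

/-- **Cha 2005 Rmk. 25, upper half, AT `p = 3`, BY KERNEL for every irreducible `E[3]`** (= `hChaU` of 21420's mono branch at `p = 3`) on frames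
with `2` not inert and `3` split in `K` (automatic on the corner): image inputs from `kolyvaginImageInputs_three_of_not_dvd_discr`, ring-class
no-torsion from x11b3's `NoTorsionIrr`. CONDITIONAL on `casselsTate_levelInputs K` and `prop37_2_frobeniusCongruence` only.
[cite: Cha2005, Thm. 21 and Rmk. 25 (pp. 173–175)] [cite: MatarNekovar2019, Thm. 0.7, §0.11] [cite: McCallumLMS1991, §5 Cor. 5.6] [cite: GrossLMS1991, §9, Prop. 9.3] -/
theorem cha_rmk25_upper_three_of_casselsTate_of_frobeniusCongruence
    [W.IsElliptic] [W.IsGloballyMinimal] [NeZero (W.conductorNorm ℤ)]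
    (hCT : casselsTate_levelInputs K) (h372 : GrossLMS1991.prop37_2_frobeniusCongruence)
    (hK : IsImaginaryQuadratic K) (hD3 : NumberField.discr K ≠ -3) (hD4 : NumberField.discr K ≠ -4)
    (hH : SatisfiesHeegnerHypothesis (W.conductorNorm ℤ) K)
    (h2 : ¬ (Ideal.span {((2 : ℕ) : 𝓞 K)}).IsPrime)
    (h3 : ((Ideal.span {((3 : ℕ) : ℤ)}).primesOver (𝓞 K)).ncard = 2)
    (hirr : W.HasIrreducibleModPGaloisRep 3)
    (ι : K →+* ℂ) (Dt : ModularParametrizationData W (W.conductorNorm ℤ)) {β : ℤ}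
    (d₁ : KolyvaginHeegnerData Dt β ι 1) {P : (W.baseChange K).toAffine.Point}
    (hPd : d₁.toGeomPoints d₁.derivedPoint = toGeomPoints (W.baseChange K) P)
    (hnt : ¬ IsOfFinAddOrder P) {M₀ : ℕ}
    (hM₀div : ∃ Q : (W.baseChange K).toAffine.Point, ((3 ^ M₀ : ℕ) : ℤ) • Q = P)
    (hM₀max : ¬ ∃ Q : (W.baseChange K).toAffine.Point, ((3 ^ (M₀ + 1) : ℕ) : ℤ) • Q = P)
    (t : ℕ)
    (hglob : ∀ (s : ℕ), s ≤ t → ∀ (n : ℕ) (d : KolyvaginHeegnerData Dt β ι n), Squarefree n →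
      (∀ ℓ ∈ n.primeFactors, Zhang2014.IsKolyvaginPrime (W.conductorNorm ℤ) W K 3 ℓ ∧
        s ≤ Zhang2014.kolyvaginIndex W 3 ℓ) →
      ∃ Q : (W.baseChange (ringClassField K ι n)).toAffine.Point, ((3 ^ s : ℕ) : ℤ) • Q = d.derivedPoint) :
    padicValNat 3 (Nat.card (AddCommGroup.primaryComponent (W.baseChange K).sha 3)) + 2 * t ≤ 2 * M₀ := by
  haveI : Fact (Nat.Prime 3) := ⟨Nat.prime_three⟩
  have hp : (3 : ℕ).Prime := Nat.prime_three
  have hp2 : (3 : ℕ) ≠ 2 := by decide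
  have h3d : ¬ ((3 : ℕ) : ℤ) ∣ NumberField.discr K :=
    ShimuraKolyvaginImageInputs.not_dvd_discr_of_ncard_primesOver_eq_two K hK.1 hp h3
  obtain ⟨hIz, hIs, hIc, hIt⟩ := kolyvaginImageInputs_three_of_not_dvd_discr K W (∅ : Finset ℕ) rfl hirr hK
    (fun ℓ hℓ ↦ absurd hℓ (Finset.notMem_empty ℓ)) (fun ℓ hℓ hℓN _ ↦ hH ℓ hℓ hℓN) h3d
  -- no `3`-power torsion over the ring class fields of conductor prime to `3` (x11b3 `NoTorsionIrr`; `3` unramified in `K`)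
  have hKunr : ∀ v : HeightOneSpectrum (𝓞 ℚ), ((3 : ℕ) : 𝓞 ℚ) ∈ v.asIdeal →
      Algebra.IsUnramifiedIn (𝓞 K) v.asIdeal := isUnramifiedIn_of_ncard_primesOver_eq_two hK.1 hp h3
  have htor : ∀ k' : ℕ, k' ≠ 0 → ¬ 3 ∣ k' →
      ∀ (n' : ℕ) (a : (W.baseChange (ringClassField K ι k')).toAffine.Point),
        ((3 ^ n' : ℕ) : ℤ) • a = 0 → a = 0 := by
    intro k' hk' h3k' n' a ha
    have hbot := NoTorsionIrr.torsionBy_pow_ringClassField_eq_bot_of_hasIrreducibleModPGaloisRep W hK ι hk' hp hp2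
      hirr (W.exists_weilPairing_holds 3) hKunr h3k' n'
    have hmem : a ∈ AddSubgroup.torsionBy (W.baseChange (ringClassField K ι k')).toAffine.Point ((3 ^ n' : ℕ) : ℤ) :=
      (Submodule.mem_torsionBy_iff _ _).mpr ha
    rwa [hbot, AddSubgroup.mem_bot] at hmem
  exact padicValNat_card_sha_primary_add_le_of_globalDivisibility_ofImage hCT h372 hK hD3 hD4 hH h2 hp2 hIz hIs
    hIc hIt ι htor Dt d₁ hPd hnt hM₀div hM₀max t hglob

end Summit.BirchSwinnertonDyer.BirchSwinnertonDyer.Theorems.ModularHeegnerCha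

end
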